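import Summits.ValiantsHypothesis.ValiantsHypothesis.Theorems.LacunarySymmetroidMatrixDescartesCensusDoorA34Isotropic
import Summits.ValiantsHypothesis.ValiantsHypothesis.Theorems.LacunarySymmetroidMatrixDescartesCensusDoorA34Letters
import Summits.ValiantsHypothesis.ValiantsHypothesis.Theorems.LacunarySymmetroidMatrixDescartesCensusDoorA34Coeffs
import Summits.ValiantsHypothesis.ValiantsHypothesis.Theorems.LacunarySymmetroidMatrixDescartesCensusDoorA34Box
import Summits.ValiantsHypothesis.ValiantsHypothesis.Theorems.LacunarySymmetroidMatrixDescartesCensusFullAlternation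
import Summits.ValiantsHypothesis.ValiantsHypothesis.Theorems.LacunarySymmetroidMatrixDescartesCensusNewtonCone
import Summits.ValiantsHypothesis.ValiantsHypothesis.Theorems.LacunarySymmetroidMatrixDescartesCensusLP34Kit

/-!
# `MatrixDescartes` census — DOOR A at `(3,4)`: the TANGENT-PENCIL PARITY LAW — a Descartes deficiency `Z₊ ≤ 18` inside the
# all-indefinite word, for isotropic pencils whose border direction contains a monomial (all supports passing a parity test)

HONEST FRAMING.  Object-search cell `pub-symmetroid`, door-A seat `val-sym-door-p3` (g14); helper file beside the OPEN typed
statement `DoorA34 = PosRootLawAt 3 4 18` (route item `Theses.LacunarySymmetroid.DoorA34`, stmt-ValiantsHypothesis-19980), asserted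
nowhere.  Continuation of `…CensusDoorA34Isotropic` / `…IsotropicGauge` (the ISOTROPIC sub-family: letters
`!![a_l, c_l, u_l; c_l, b_l, v_l; u_l, v_l, 0]`, i.e. four conics through a common point, the border `(u_l : v_l)` being the tangent
direction of conic `l` there; `det = −(A·V² − 2·Cc·U·V + B·U²)`).

THE SUB-FAMILY.  `u_l = 0` for every `l ≠ m`: the border `K`-nomial `U` is the single monomial `u_m X^(d m)`; geometrically the three
conics `l ≠ m` are mutually TANGENT at the common point (a «tangent pencil» plus one free conic through the point); in the cubic-surface
picture of `…IsotropicGauge` the singular line lies in the coordinate face `y_m = 0`.  At `K = 4` this is a `10`-parameter family of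
real symmetric `(3,4)` pencils, every letter INDEFINITE and (generically) nonsingular, with ALL `20` triple-sum monomials present — a
piece of the all-indefinite word `IIII`, where the cell's support-level certificates have no rows (engine-2 `CUBIC-REREP.md` §13.2).

THE LAW (all of it kernel-checked here, for every support):
* `det_isoLetter_tangent`, `trace_adjugate_isoLetter_tangent` — on the face avoiding `m` the pencil determinant is the product
  `−A'·V'²`: `det S_i = −a_i v_i²` and `tr(adj S_i · S_j) = −(2 a_i v_i v_j + a_j v_i²)` for `i, j ≠ m`; so on each EDGE `{i,j}` of that
  face the four coefficients at `3d_i, 2d_i+d_j, d_i+2d_j, 3d_j` are (minus) those of the binary cubic `(a_i + a_j s)(v_i + v_j s)²`,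
  which is REAL-ROOTED WITH A DOUBLE ROOT `s = −v_i/v_j`;
* `doubleRoot_neg_of_*`, `doubleRoot_pos_of_*` — DESCARTES IS EXACT for such a cubic: if at least two of its three adjacent
  coefficient pairs alternate then `v_i v_j < 0`, if at least two are permanences then `v_i v_j > 0` (six elementary sign lemmas);
* `tangent_edge_sign` — for a pencil with NINETEEN distinct positive det-roots (full alternation, `…CensusFullAlternation`
  `pow_rank_mul_coeff_mul_coeff_pos_of_sharp`; dictionary `…DoorA34Coeffs/Letters`) the number of alternations on the edge `{i,j}` is
  read off the RANKS of the four edge exponents in the triple-sum table of `d`, hence the sign of `v_i v_j` is a function of `d` alone;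
* **`card_posRoots_isoTangent_le_18`** — the three edges of the face give three forced signs whose product must be
  `(v_i v_j v_k)² ≥ 0`; when the parity test `Odd (τ_ij + τ_ik + τ_jk)` on `d` holds (an odd number of edges force «negative») a
  nineteen is impossible: **`Z₊ ≤ 18 = D(3,4) − 1`, one below the Descartes bound, on every support passing the test**;
  instances by `decide`: `card_posRoots_isoTangent_le_18_on_0_1_4_13` (m = 0), `…_on_0_1_7_11` (m = 0), `…_on_0_2_5_26_top` (m = 3).

SCOPE (located bookkeeping, seat script `parity.py`, not a theorem): the test holds for `920/1088/1088/920` of the `2060` sorted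
3-Sidon supports `d₃ ≤ 30` at `m = 0/1/2/3` (`1658` for some `m`, `350` for all; the rail `(0,1,4,N)`, `13 ≤ N ≤ 30`, at `m ∈ {0,1}`);
where it fails the family DOES realise full alternation (located), so the law is exactly the sign-level content of the mechanism.
Nothing here bounds `ζ_sym(3,4)` (`∈ {18,19}` unchanged), the general isotropic sub-door, or `DoorA34`; nothing bears on `MatrixDescartes`
(stmt-ValiantsHypothesis-18050) or on `VP ≠ VNP` — VP≠VNP not moved.

[folklore] Descartes' rule of signs is exact for real-rooted polynomials; polarisation of the determinant; elementary.
-/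

-- `Summit.ValiantsHypothesis.ValiantsHypothesis.…` repeats a component by the D-0017 layout
-- (single-conjunct summit), which the `dupNamespace` linter flags; the name is mandated.
set_option linter.dupNamespace false

namespace Summit.ValiantsHypothesis.ValiantsHypothesis.Theorems.LacunarySymmetroidMatrixDescartes.Census

open Polynomial Finset
open scoped BigOperators Polynomial Matrix

/-! ## 1. Descartes is exact for a binary cubic with a double root -/

/-- The binary cubic `(α + βs)(γ + δs)² = αγ² + (2αγδ + βγ²)s + (αδ² + 2βγδ)s² + βδ²s³` has the double root `s = −γ/δ`; its three
adjacent coefficient products in the variables `g = γδ`, `X = αδ`, `Y = βγ`: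
`δ²·P₀P₁ = γ²·g·X(2X+Y)`, `P₁P₂ = g·(2X+Y)(X+2Y)`, `γ²·P₂P₃ = δ²·g·Y(X+2Y)`. [folklore] -/
theorem doubleRoot_products (α β γ δ : ℝ) :
    δ ^ 2 * ((α * γ ^ 2) * (2 * α * γ * δ + β * γ ^ 2))
        = γ ^ 2 * ((γ * δ) * ((α * δ) * (2 * (α * δ) + β * γ))) ∧
      (2 * α * γ * δ + β * γ ^ 2) * (α * δ ^ 2 + 2 * β * γ * δ)
        = (γ * δ) * ((2 * (α * δ) + β * γ) * (α * δ + 2 * (β * γ))) ∧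
      γ ^ 2 * ((α * δ ^ 2 + 2 * β * γ * δ) * (β * δ ^ 2))
        = δ ^ 2 * ((γ * δ) * ((β * γ) * (α * δ + 2 * (β * γ)))) := by
  refine ⟨by ring, by ring, by ring⟩

/-- Arithmetic core, low pair: `X(2X+Y) < 0` and `(2X+Y)(X+2Y) < 0` are incompatible. [folklore] -/
theorem not_low_and_mid_neg (X Y : ℝ) (h1 : X * (2 * X + Y) < 0) (h2 : (2 * X + Y) * (X + 2 * Y) < 0) : False := by
  nlinarith [sq_nonneg (2 * X + Y), sq_nonneg X, mul_pos_iff.mp (show 0 < (X * (2 * X + Y)) * ((2 * X + Y) * (X + 2 * Y)) from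
    mul_pos_of_neg_of_neg h1 h2)]

/-- Arithmetic core, outer pair: `X(2X+Y) < 0` and `Y(X+2Y) < 0` are incompatible. [folklore] -/
theorem not_low_and_high_neg (X Y : ℝ) (h1 : X * (2 * X + Y) < 0) (h3 : Y * (X + 2 * Y) < 0) : False := by
  nlinarith [sq_nonneg (X + Y), sq_nonneg X, sq_nonneg Y]

/-- **Two alternations at the low end force the double root positive**: `P₀P₁ < 0`, `P₁P₂ < 0` ⇒ `γδ < 0`. [folklore] -/
theorem doubleRoot_neg_of_alt_low {α β γ δ : ℝ}
    (h01 : (α * γ ^ 2) * (2 * α * γ * δ + β * γ ^ 2) < 0)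
    (h12 : (2 * α * γ * δ + β * γ ^ 2) * (α * δ ^ 2 + 2 * β * γ * δ) < 0) : γ * δ < 0 := by
  obtain ⟨e01, e12, -⟩ := doubleRoot_products α β γ δ
  rw [e12] at h12
  rcases lt_trichotomy (γ * δ) 0 with hneg | hzero | hpos
  · exact hneg
  · rw [hzero, zero_mul] at h12; exact absurd h12 (lt_irrefl 0)
  · exfalso
    have hγ : γ ≠ 0 := by rintro rfl; simp at hpos
    have hδ : δ ≠ 0 := by rintro rfl; simp at hpos
    obtain ⟨hγ2, hδ2⟩ : 0 < γ ^ 2 ∧ 0 < δ ^ 2 := ⟨by positivity, by positivity⟩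
    have h2 : (2 * (α * δ) + β * γ) * (α * δ + 2 * (β * γ)) < 0 := by
      by_contra h; push Not at h; exact absurd h12 (not_lt.mpr (mul_nonneg hpos.le h))
    have h1 : (α * δ) * (2 * (α * δ) + β * γ) < 0 := by
      have hh : δ ^ 2 * ((α * γ ^ 2) * (2 * α * γ * δ + β * γ ^ 2)) < 0 := mul_neg_of_pos_of_neg hδ2 h01
      rw [e01] at hh
      by_contra h; push Not at h
      exact absurd hh (not_lt.mpr (mul_nonneg hγ2.le (mul_nonneg hpos.le h)))
    exact not_low_and_mid_neg _ _ h1 h2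

/-- **Two alternations at the high end force the double root positive**: `P₁P₂ < 0`, `P₂P₃ < 0` ⇒ `γδ < 0` (mirror). [folklore] -/
theorem doubleRoot_neg_of_alt_high {α β γ δ : ℝ}
    (h12 : (2 * α * γ * δ + β * γ ^ 2) * (α * δ ^ 2 + 2 * β * γ * δ) < 0)
    (h23 : (α * δ ^ 2 + 2 * β * γ * δ) * (β * δ ^ 2) < 0) : γ * δ < 0 := by
  have h := doubleRoot_neg_of_alt_low (α := β) (β := α) (γ := δ) (δ := γ) (by linarith [h23]) (by linarith [h12])
  linarith [h]

/-- **Alternations at both ends force the double root positive**: `P₀P₁ < 0`, `P₂P₃ < 0` ⇒ `γδ < 0`. [folklore] -/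
theorem doubleRoot_neg_of_alt_ends {α β γ δ : ℝ}
    (h01 : (α * γ ^ 2) * (2 * α * γ * δ + β * γ ^ 2) < 0)
    (h23 : (α * δ ^ 2 + 2 * β * γ * δ) * (β * δ ^ 2) < 0) : γ * δ < 0 := by
  obtain ⟨e01, -, e23⟩ := doubleRoot_products α β γ δ
  have hγ : γ ≠ 0 := by rintro rfl; simp at h01
  have hδ : δ ≠ 0 := by rintro rfl; simp at h23
  obtain ⟨hγ2, hδ2⟩ : 0 < γ ^ 2 ∧ 0 < δ ^ 2 := ⟨by positivity, by positivity⟩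
  rcases lt_or_ge (γ * δ) 0 with hneg | hge
  · exact hneg
  · exfalso
    have h1 : (α * δ) * (2 * (α * δ) + β * γ) < 0 := by
      have hh : δ ^ 2 * ((α * γ ^ 2) * (2 * α * γ * δ + β * γ ^ 2)) < 0 := mul_neg_of_pos_of_neg hδ2 h01
      rw [e01] at hh
      by_contra h; push Not at h
      exact absurd hh (not_lt.mpr (mul_nonneg hγ2.le (mul_nonneg hge h)))
    have h3 : (β * γ) * (α * δ + 2 * (β * γ)) < 0 := by
      have hh : γ ^ 2 * ((α * δ ^ 2 + 2 * β * γ * δ) * (β * δ ^ 2)) < 0 := mul_neg_of_pos_of_neg hγ2 h23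
      rw [e23] at hh
      by_contra h; push Not at h
      exact absurd hh (not_lt.mpr (mul_nonneg hδ2.le (mul_nonneg hge h)))
    exact not_low_and_high_neg _ _ h1 h3

/-- **Two permanences at the low end force the double root negative**: `P₀P₁ > 0`, `P₁P₂ > 0` ⇒ `γδ > 0`. [folklore] -/
theorem doubleRoot_pos_of_perm_low {α β γ δ : ℝ}
    (h01 : 0 < (α * γ ^ 2) * (2 * α * γ * δ + β * γ ^ 2))
    (h12 : 0 < (2 * α * γ * δ + β * γ ^ 2) * (α * δ ^ 2 + 2 * β * γ * δ)) : 0 < γ * δ := by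
  obtain ⟨e01, e12, -⟩ := doubleRoot_products α β γ δ
  rw [e12] at h12
  rcases lt_trichotomy (γ * δ) 0 with hneg | hzero | hpos
  · exfalso
    have hγ : γ ≠ 0 := by rintro rfl; simp at hneg
    have hδ : δ ≠ 0 := by rintro rfl; simp at hneg
    obtain ⟨hγ2, hδ2⟩ : 0 < γ ^ 2 ∧ 0 < δ ^ 2 := ⟨by positivity, by positivity⟩
    have h2 : (2 * (α * δ) + β * γ) * (α * δ + 2 * (β * γ)) < 0 := by
      by_contra h; push Not at h; exact absurd h12 (not_lt.mpr (mul_nonpos_of_nonpos_of_nonneg hneg.le h))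
    have h1 : (α * δ) * (2 * (α * δ) + β * γ) < 0 := by
      have hh : 0 < δ ^ 2 * ((α * γ ^ 2) * (2 * α * γ * δ + β * γ ^ 2)) := mul_pos hδ2 h01
      rw [e01] at hh
      by_contra h; push Not at h
      exact absurd hh (not_lt.mpr (mul_nonpos_of_nonneg_of_nonpos hγ2.le (mul_nonpos_of_nonpos_of_nonneg hneg.le h)))
    exact not_low_and_mid_neg _ _ h1 h2
  · rw [hzero, zero_mul] at h12; exact absurd h12 (lt_irrefl 0)
  · exact hpos

/-- **Two permanences at the high end force the double root negative** (mirror). [folklore] -/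
theorem doubleRoot_pos_of_perm_high {α β γ δ : ℝ}
    (h12 : 0 < (2 * α * γ * δ + β * γ ^ 2) * (α * δ ^ 2 + 2 * β * γ * δ))
    (h23 : 0 < (α * δ ^ 2 + 2 * β * γ * δ) * (β * δ ^ 2)) : 0 < γ * δ := by
  have h := doubleRoot_pos_of_perm_low (α := β) (β := α) (γ := δ) (δ := γ) (by linarith [h23]) (by linarith [h12])
  linarith [h]

/-- **Permanences at both ends force the double root negative**: `P₀P₁ > 0`, `P₂P₃ > 0` ⇒ `γδ > 0`. [folklore] -/
theorem doubleRoot_pos_of_perm_ends {α β γ δ : ℝ}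
    (h01 : 0 < (α * γ ^ 2) * (2 * α * γ * δ + β * γ ^ 2))
    (h23 : 0 < (α * δ ^ 2 + 2 * β * γ * δ) * (β * δ ^ 2)) : 0 < γ * δ := by
  obtain ⟨e01, -, e23⟩ := doubleRoot_products α β γ δ
  have hγ : γ ≠ 0 := by rintro rfl; simp at h01
  have hδ : δ ≠ 0 := by rintro rfl; simp at h23
  obtain ⟨hγ2, hδ2⟩ : 0 < γ ^ 2 ∧ 0 < δ ^ 2 := ⟨by positivity, by positivity⟩
  rcases lt_or_ge 0 (γ * δ) with hpos | hle
  · exact hpos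
  · exfalso
    have h1 : (α * δ) * (2 * (α * δ) + β * γ) < 0 := by
      have hh : 0 < δ ^ 2 * ((α * γ ^ 2) * (2 * α * γ * δ + β * γ ^ 2)) := mul_pos hδ2 h01
      rw [e01] at hh
      by_contra h; push Not at h
      exact absurd hh (not_lt.mpr (mul_nonpos_of_nonneg_of_nonpos hγ2.le (mul_nonpos_of_nonpos_of_nonneg hle h)))
    have h3 : (β * γ) * (α * δ + 2 * (β * γ)) < 0 := by
      have hh : 0 < γ ^ 2 * ((α * δ ^ 2 + 2 * β * γ * δ) * (β * δ ^ 2)) := mul_pos hγ2 h23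
      rw [e23] at hh
      by_contra h; push Not at h
      exact absurd hh (not_lt.mpr (mul_nonpos_of_nonneg_of_nonpos hδ2.le (mul_nonpos_of_nonpos_of_nonneg hle h)))
    exact not_low_and_high_neg _ _ h1 h3

/-- **Descartes is exact on a double-root edge, parity form.**  If the three adjacent products of the coefficients
`c₀ = −αγ², c₁ = −(2αγδ+βγ²), c₂ = −(αδ²+2βγδ), c₃ = −βδ²` have the signs `(−1)^{s₁}, (−1)^{s₂}, (−1)^{s₃}`, then `γδ < 0` when at
least two of the `sₖ` are odd, and `γδ > 0` when at most one is. [folklore] -/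
theorem doubleRoot_sign_of_parities {α β γ δ c₀ c₁ c₂ c₃ : ℝ} {s₁ s₂ s₃ : ℕ}
    (hc₀ : c₀ = -(α * γ ^ 2)) (hc₁ : c₁ = -(2 * α * γ * δ + β * γ ^ 2)) (hc₂ : c₂ = -(α * δ ^ 2 + 2 * β * γ * δ))
    (hc₃ : c₃ = -(β * δ ^ 2))
    (h₁ : 0 < (-1 : ℝ) ^ s₁ * (c₀ * c₁)) (h₂ : 0 < (-1 : ℝ) ^ s₂ * (c₁ * c₂)) (h₃ : 0 < (-1 : ℝ) ^ s₃ * (c₂ * c₃)) :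
    (2 ≤ s₁ % 2 + s₂ % 2 + s₃ % 2 → γ * δ < 0) ∧ (s₁ % 2 + s₂ % 2 + s₃ % 2 ≤ 1 → 0 < γ * δ) := by
  have e1 : c₀ * c₁ = (α * γ ^ 2) * (2 * α * γ * δ + β * γ ^ 2) := by rw [hc₀, hc₁]; ring
  have e2 : c₁ * c₂ = (2 * α * γ * δ + β * γ ^ 2) * (α * δ ^ 2 + 2 * β * γ * δ) := by rw [hc₁, hc₂]; ring
  have e3 : c₂ * c₃ = (α * δ ^ 2 + 2 * β * γ * δ) * (β * δ ^ 2) := by rw [hc₂, hc₃]; ring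
  rw [e1] at h₁; rw [e2] at h₂; rw [e3] at h₃
  -- translate parities into signs
  have neg_of_odd : ∀ {s : ℕ} {x : ℝ}, 0 < (-1 : ℝ) ^ s * x → s % 2 = 1 → x < 0 := fun {s x} hx hs => by
    rw [(Nat.odd_iff.mpr hs).neg_one_pow] at hx; linarith
  have pos_of_even : ∀ {s : ℕ} {x : ℝ}, 0 < (-1 : ℝ) ^ s * x → s % 2 = 0 → 0 < x := fun {s x} hx hs => by
    rw [(Nat.even_iff.mpr hs).neg_one_pow] at hx; linarith
  obtain ⟨m1, m2, m3⟩ := And.intro (Nat.mod_two_eq_zero_or_one s₁) (And.intro (Nat.mod_two_eq_zero_or_one s₂) (Nat.mod_two_eq_zero_or_one s₃))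
  constructor
  · intro hge
    rcases m1 with a | a <;> rcases m2 with b | b <;> rcases m3 with c | c <;> rw [a, b, c] at hge <;> norm_num at hge
    · exact doubleRoot_neg_of_alt_high (neg_of_odd h₂ b) (neg_of_odd h₃ c)
    · exact doubleRoot_neg_of_alt_ends (neg_of_odd h₁ a) (neg_of_odd h₃ c)
    · exact doubleRoot_neg_of_alt_low (neg_of_odd h₁ a) (neg_of_odd h₂ b)
    · exact doubleRoot_neg_of_alt_low (neg_of_odd h₁ a) (neg_of_odd h₂ b)
  · intro hle
    rcases m1 with a | a <;> rcases m2 with b | b <;> rcases m3 with c | c <;> rw [a, b, c] at hle <;> norm_num at hle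
    · exact doubleRoot_pos_of_perm_low (pos_of_even h₁ a) (pos_of_even h₂ b)
    · exact doubleRoot_pos_of_perm_low (pos_of_even h₁ a) (pos_of_even h₂ b)
    · exact doubleRoot_pos_of_perm_ends (pos_of_even h₁ a) (pos_of_even h₃ c)
    · exact doubleRoot_pos_of_perm_high (pos_of_even h₂ b) (pos_of_even h₃ c)

/-! ## 2. The tangent letters: the face block is `−A'·V'²` -/

/-- **Determinant of a tangent letter**: `det !![a, c, 0; c, b, v; 0, v, 0] = −a·v²`. [folklore] -/
theorem det_isoLetter_tangent {K : ℕ} (E : Fin 5 → Fin K → ℝ) {l : Fin K} (hl : E 3 l = 0) :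
    (!![E 0 l, E 2 l, E 3 l; E 2 l, E 1 l, E 4 l; E 3 l, E 4 l, 0] : Matrix (Fin 3) (Fin 3) ℝ).det
      = -(E 0 l * E 4 l ^ 2) := by
  rw [Matrix.det_fin_three]; simp [hl]; ring

/-- **Polarised determinant of two tangent letters**: `tr(adj S_i · S_j) = −(2 a_i v_i v_j + a_j v_i²)` when `u_i = u_j = 0`
(the `t`-derivative at `0` of `det (S_i + t S_j) = −(a_i + t a_j)(v_i + t v_j)²`). [folklore] -/
theorem trace_adjugate_isoLetter_tangent {K : ℕ} (E : Fin 5 → Fin K → ℝ) {i j : Fin K} (hi : E 3 i = 0) (hj : E 3 j = 0) :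
    ((!![E 0 i, E 2 i, E 3 i; E 2 i, E 1 i, E 4 i; E 3 i, E 4 i, 0] : Matrix (Fin 3) (Fin 3) ℝ).adjugate
        * (!![E 0 j, E 2 j, E 3 j; E 2 j, E 1 j, E 4 j; E 3 j, E 4 j, 0] : Matrix (Fin 3) (Fin 3) ℝ)).trace
      = -(2 * E 0 i * E 4 i * E 4 j + E 0 j * E 4 i ^ 2) := by
  simp only [Matrix.trace_fin_three, Matrix.mul_apply, Fin.sum_univ_three, Matrix.adjugate_fin_three, Matrix.of_apply,
    Matrix.cons_val', Matrix.cons_val_zero, Matrix.cons_val_one, Matrix.cons_val_two, Matrix.empty_val',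
    Matrix.cons_val_fin_one, Matrix.head_cons, Matrix.tail_cons, Matrix.head_fin_const, hi, hj]
  ring

/-- Finite bookkeeping: a map `f : Fin 3 → Fin 4` with the value multiset `{i, i, k}` (`i ≠ k`) is one of the three arrangements.
[folklore] -/
theorem fin3_of_univ_val_map_eq (i k : Fin 4) (hik : i ≠ k) (f : Fin 3 → Fin 4)
    (h : Finset.univ.val.map f = Finset.univ.val.map (![i, i, k] : Fin 3 → Fin 4)) :
    f = ![i, i, k] ∨ f = ![i, k, i] ∨ f = ![k, i, i] := by
  revert i k hik f; decide

/-- `19` positive roots ⇒ the square exponent `2·d i + d k` (`i ≠ k`) is represented only by the arrangements of `{i,i,k}`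
(from `sym_sum_injective_of_nineteen`). [folklore] -/
theorem square_unique_of_nineteen (d : Fin 4 → ℕ) (S : Fin 4 → Matrix (Fin 3) (Fin 3) ℝ)
    (h19 : 19 ≤ ((Matrix.det (∑ l, ((X : ℝ[X]) ^ d l) • (S l).map C)).roots.toFinset.filter (fun t => 0 < t)).card)
    {i k : Fin 4} (hik : i ≠ k) :
    ∀ f : Fin 3 → Fin 4, (∑ t, d (f t)) = 2 * d i + d k → f = ![i, i, k] ∨ f = ![i, k, i] ∨ f = ![k, i, i] := by
  intro f hf
  have hinj := sym_sum_injective_of_nineteen d S h19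
  have hg : (∑ t, d ((![i, i, k] : Fin 3 → Fin 4) t)) = 2 * d i + d k := by
    simp [Fin.sum_univ_three]; ring
  have hsum : (((⟨Finset.univ.val.map f, StubDescartesCeiling.card_map_univ_val f⟩ : Sym (Fin 4) 3) : Multiset (Fin 4)).map d).sum
      = (((⟨Finset.univ.val.map (![i, i, k] : Fin 3 → Fin 4), StubDescartesCeiling.card_map_univ_val _⟩ : Sym (Fin 4) 3) :
          Multiset (Fin 4)).map d).sum := by
    change ((Finset.univ.val.map f).map d).sum = ((Finset.univ.val.map (![i, i, k] : Fin 3 → Fin 4)).map d).sum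
    rw [← StubDescartesCeiling.sum_eq_sym_sum, ← StubDescartesCeiling.sum_eq_sym_sum, hf, hg]
  exact fin3_of_univ_val_map_eq i k hik f (congrArg (fun s : Sym (Fin 4) 3 => (s : Multiset (Fin 4))) (hinj hsum))

/-! ## 3. A nineteen of the tangent family: the edge signs are read off the support -/

/-- **Edge sign law for a tangent nineteen.**  Let the isotropic pencil with letters `!![a_l,c_l,u_l; c_l,b_l,v_l; u_l,v_l,0]` have
`u_i = u_j = 0` (`i ≠ j`) and `19` distinct positive det-roots, and let `ρ e` be the rank of `e` in the triple-sum table of `d`.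
With `s₁ = ρ(3dᵢ) + ρ(2dᵢ+dⱼ)`, `s₂ = ρ(2dᵢ+dⱼ) + ρ(2dⱼ+dᵢ)`, `s₃ = ρ(2dⱼ+dᵢ) + ρ(3dⱼ)`: if at least two of the `sₖ` are odd then
`v_i v_j < 0`, and if at most one is odd then `v_i v_j > 0`. [folklore] -/
theorem tangent_edge_sign (d : Fin 4 → ℕ) (E : Fin 5 → Fin 4 → ℝ) {i j : Fin 4} (hij : i ≠ j) (hi : E 3 i = 0) (hj : E 3 j = 0)
    (h19 : 19 ≤ (((∑ l, (X : ℝ[X]) ^ d l • (!![E 0 l, E 2 l, E 3 l; E 2 l, E 1 l, E 4 l; E 3 l, E 4 l, 0] :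
      Matrix (Fin 3) (Fin 3) ℝ).map C).det).roots.toFinset.filter (fun t => 0 < t)).card)
    (ρ : ℕ → ℕ) (hρ : ∀ e, ρ e = (((Finset.univ : Finset (Fin 4 × Fin 4 × Fin 4)).image
      (fun p => d p.1 + d p.2.1 + d p.2.2)).filter (· < e)).card) :
    (2 ≤ (ρ (3 * d i) + ρ (2 * d i + d j)) % 2 + (ρ (2 * d i + d j) + ρ (2 * d j + d i)) % 2
        + (ρ (2 * d j + d i) + ρ (3 * d j)) % 2 → E 4 i * E 4 j < 0) ∧
    ((ρ (3 * d i) + ρ (2 * d i + d j)) % 2 + (ρ (2 * d i + d j) + ρ (2 * d j + d i)) % 2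
        + (ρ (2 * d j + d i) + ρ (3 * d j)) % 2 ≤ 1 → 0 < E 4 i * E 4 j) := by
  classical
  set S : Fin 4 → Matrix (Fin 3) (Fin 3) ℝ :=
    fun l => !![E 0 l, E 2 l, E 3 l; E 2 l, E 1 l, E 4 l; E 3 l, E 4 l, 0] with hSdef
  set P : ℝ[X] := (∑ l, (X : ℝ[X]) ^ d l • (S l).map C).det with hPdef
  have h19' : 19 ≤ (P.roots.toFinset.filter (fun t => 0 < t)).card := h19
  have hP0 : P ≠ 0 := fun h0 => by
    rw [h0, Polynomial.roots_zero, Multiset.toFinset_zero, Finset.filter_empty, Finset.card_empty] at h19'; omega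
  set T : Finset ℕ := (Finset.univ : Finset (Fin 4 × Fin 4 × Fin 4)).image (fun p => d p.1 + d p.2.1 + d p.2.2) with hTdef
  have hT20 : T.card ≤ 20 := card_tripleSums_le_of_collapse d id (fun _ => rfl) (by decide)
  have hsum3 : (Finset.univ : Finset (Fin 3 → Fin 4)).image (fun g => ∑ t, d (g t)) = T := sumset_three_eq_tripleSums d
  have hZ : ((Finset.univ : Finset (Fin 3 → Fin 4)).image (fun g => ∑ t, d (g t))).card
      ≤ (P.roots.toFinset.filter (fun t => 0 < t)).card + 1 := by rw [hsum3]; omega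
  have hsupp : P.support = T := by rw [← hsum3]; exact support_det_pencil_eq_sumset_of_sharp d S hP0 hZ
  have hZ' : P.support.card ≤ (P.roots.toFinset.filter (fun t => 0 < t)).card + 1 := by rw [hsupp]; omega
  have memT : ∀ a b c : Fin 4, d a + d b + d c ∈ P.support := fun a b c => by
    rw [hsupp, hTdef]; exact Finset.mem_image.mpr ⟨(a, b, c), Finset.mem_univ _, rfl⟩
  have hrank : ∀ e, (P.support.filter (· < e)).card = ρ e := fun e => by rw [hρ, hsupp]
  have hc0 : P.coeff (3 * d i) = -(E 0 i * E 4 i ^ 2) := by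
    rw [hPdef, coeff_det_pencil_three_mul d S i (cube_unique_of_nineteen d S h19' i), hSdef]
    exact det_isoLetter_tangent E hi
  have hc3 : P.coeff (3 * d j) = -(E 0 j * E 4 j ^ 2) := by
    rw [hPdef, coeff_det_pencil_three_mul d S j (cube_unique_of_nineteen d S h19' j), hSdef]
    exact det_isoLetter_tangent E hj
  have hc1 : P.coeff (2 * d i + d j) = -(2 * E 0 i * E 4 i * E 4 j + E 0 j * E 4 i ^ 2) := by
    rw [hPdef, coeff_det_pencil_three_square d S hij (square_unique_of_nineteen d S h19' hij), hSdef]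
    exact trace_adjugate_isoLetter_tangent E hi hj
  have hc2 : P.coeff (2 * d j + d i) = -(E 0 i * E 4 j ^ 2 + 2 * E 0 j * E 4 i * E 4 j) := by
    rw [hPdef, coeff_det_pencil_three_square d S hij.symm (square_unique_of_nineteen d S h19' hij.symm), hSdef,
      trace_adjugate_isoLetter_tangent E hj hi]
    ring
  have m0 : 3 * d i ∈ P.support := by rw [show 3 * d i = d i + d i + d i by ring]; exact memT i i i
  have m3 : 3 * d j ∈ P.support := by rw [show 3 * d j = d j + d j + d j by ring]; exact memT j j j
  have m1 : 2 * d i + d j ∈ P.support := by rw [show 2 * d i + d j = d i + d i + d j by ring]; exact memT i i j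
  have m2 : 2 * d j + d i ∈ P.support := by rw [show 2 * d j + d i = d j + d j + d i by ring]; exact memT j j i
  have r1 := pow_rank_mul_coeff_mul_coeff_pos_of_sharp P hZ' m0 m1; have r2 := pow_rank_mul_coeff_mul_coeff_pos_of_sharp P hZ' m1 m2
  have r3 := pow_rank_mul_coeff_mul_coeff_pos_of_sharp P hZ' m2 m3
  rw [hrank, hrank] at r1 r2 r3
  exact doubleRoot_sign_of_parities (α := E 0 i) (β := E 0 j) (γ := E 4 i) (δ := E 4 j) hc0 hc1 hc2 hc3 r1 r2 r3

/-! ## 4. The parity law -/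

/-- **TANGENT-PENCIL PARITY LAW (all supports).**  Let a real symmetric `(3,4)` pencil have isotropic letters
`!![a_l, c_l, u_l; c_l, b_l, v_l; u_l, v_l, 0]` with `u_l = 0` for the three letters `l ∈ {i, j, k}` other than `m` (the border direction
contains the monomial `X^(d m)`: a tangent pencil).  Let `ρ e` be the rank of `e` in the triple-sum table of `d`, and for an edge `{p,q}` let
`τ_pq = 1` if at least two of `ρ(3d_p)+ρ(2d_p+d_q)`, `ρ(2d_p+d_q)+ρ(2d_q+d_p)`, `ρ(2d_q+d_p)+ρ(3d_q)` are odd and `τ_pq = 0` otherwise.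
If `τ_ij + τ_ik + τ_jk` is ODD, the determinant has at most `18` distinct positive roots (Descartes allows `19`). [folklore] -/
theorem card_posRoots_isoTangent_le_18 (d : Fin 4 → ℕ) (E : Fin 5 → Fin 4 → ℝ) (m i j k : Fin 4)
    (him : i ≠ m) (hjm : j ≠ m) (hkm : k ≠ m) (hij : i ≠ j) (hik : i ≠ k) (hjk : j ≠ k)
    (hU : ∀ l, l ≠ m → E 3 l = 0)
    (ρ : ℕ → ℕ) (hρ : ∀ e, ρ e = (((Finset.univ : Finset (Fin 4 × Fin 4 × Fin 4)).image
      (fun p => d p.1 + d p.2.1 + d p.2.2)).filter (· < e)).card)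
    (hpar : Odd (
        (if 2 ≤ (ρ (3 * d i) + ρ (2 * d i + d j)) % 2 + (ρ (2 * d i + d j) + ρ (2 * d j + d i)) % 2
              + (ρ (2 * d j + d i) + ρ (3 * d j)) % 2 then 1 else 0)
      + (if 2 ≤ (ρ (3 * d i) + ρ (2 * d i + d k)) % 2 + (ρ (2 * d i + d k) + ρ (2 * d k + d i)) % 2
              + (ρ (2 * d k + d i) + ρ (3 * d k)) % 2 then 1 else 0)
      + (if 2 ≤ (ρ (3 * d j) + ρ (2 * d j + d k)) % 2 + (ρ (2 * d j + d k) + ρ (2 * d k + d j)) % 2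
              + (ρ (2 * d k + d j) + ρ (3 * d k)) % 2 then 1 else 0))) :
    ((((∑ l, (X : ℝ[X]) ^ d l • (!![E 0 l, E 2 l, E 3 l; E 2 l, E 1 l, E 4 l; E 3 l, E 4 l, 0] :
      Matrix (Fin 3) (Fin 3) ℝ).map C).det).roots.toFinset.filter (fun t => 0 < t)).card) ≤ 18 := by
  by_contra hlt; push Not at hlt
  have h19 : 19 ≤ (((∑ l, (X : ℝ[X]) ^ d l • (!![E 0 l, E 2 l, E 3 l; E 2 l, E 1 l, E 4 l; E 3 l, E 4 l, 0] :
      Matrix (Fin 3) (Fin 3) ℝ).map C).det).roots.toFinset.filter (fun t => 0 < t)).card := by omega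
  obtain ⟨nij, pij⟩ := tangent_edge_sign d E hij (hU i him) (hU j hjm) h19 ρ hρ
  obtain ⟨⟨nik, pik⟩, ⟨njk, pjk⟩⟩ := And.intro (tangent_edge_sign d E hik (hU i him) (hU k hkm) h19 ρ hρ)
    (tangent_edge_sign d E hjk (hU j hjm) (hU k hkm) h19 ρ hρ)
  have hsq : 0 ≤ (E 4 i * E 4 j) * (E 4 i * E 4 k) * (E 4 j * E 4 k) := by
    rw [show (E 4 i * E 4 j) * (E 4 i * E 4 k) * (E 4 j * E 4 k) = (E 4 i * E 4 j * E 4 k) ^ 2 by ring]; positivity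
  -- case analysis on the three edge tests
  split_ifs at hpar with h1 h2 h3 h3 h2 h3 h3
  · -- T T T : three negatives
    nlinarith [mul_pos_of_neg_of_neg (nij h1) (nik h2), njk h3]
  · -- T T F : even, excluded
    exact absurd hpar (by decide)
  · exact absurd hpar (by decide)
  · -- T F F
    push Not at h2 h3
    nlinarith [mul_pos (pik (by omega)) (pjk (by omega)), nij h1]
  · exact absurd hpar (by decide)
  · -- F T F
    push Not at h1 h3
    nlinarith [mul_pos (pij (by omega)) (pjk (by omega)), nik h2]
  · -- F F T
    push Not at h1 h2
    nlinarith [mul_pos (pij (by omega)) (pik (by omega)), njk h3]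
  · exact absurd hpar (by decide)

/-! ## 5. Instances on census supports (the parity test by `decide`) -/

/-- **`(0,1,4,13)`, border along `X^0`** (the first 3-Sidon support of the `(0,1,4,N)` rail; `m = 0`, face `{1,2,3}`): every tangent
isotropic pencil has at most `18` distinct positive det-roots. [folklore] -/
theorem card_posRoots_isoTangent_le_18_on_0_1_4_13 (E : Fin 5 → Fin 4 → ℝ) (hU : ∀ l, l ≠ 0 → E 3 l = 0) :
    ((((∑ l, (X : ℝ[X]) ^ (![0, 1, 4, 13] : Fin 4 → ℕ) l • (!![E 0 l, E 2 l, E 3 l; E 2 l, E 1 l, E 4 l; E 3 l, E 4 l, 0] :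
      Matrix (Fin 3) (Fin 3) ℝ).map C).det).roots.toFinset.filter (fun t => 0 < t)).card) ≤ 18 := by
  have hT : ((Finset.univ : Finset (Fin 4 × Fin 4 × Fin 4)).image
      (fun p => (![0, 1, 4, 13] : Fin 4 → ℕ) p.1 + (![0, 1, 4, 13] : Fin 4 → ℕ) p.2.1 + (![0, 1, 4, 13] : Fin 4 → ℕ) p.2.2))
        = ({0, 1, 2, 3, 4, 5, 6, 8, 9, 12, 13, 14, 15, 17, 18, 21, 26, 27, 30, 39} : Finset ℕ) := by decide
  refine card_posRoots_isoTangent_le_18 _ E 0 1 2 3 (by decide) (by decide) (by decide) (by decide) (by decide) (by decide) hU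
    (fun e => ((({0, 1, 2, 3, 4, 5, 6, 8, 9, 12, 13, 14, 15, 17, 18, 21, 26, 27, 30, 39} : Finset ℕ)).filter (· < e)).card) (fun e => by rw [hT]) ?_
  decide

/-- **`(0,1,7,11)`, border along `X^0`** (the first 3-Sidon support in the box `d₃ ≤ 11`; `m = 0`): at most `18`. [folklore] -/
theorem card_posRoots_isoTangent_le_18_on_0_1_7_11 (E : Fin 5 → Fin 4 → ℝ) (hU : ∀ l, l ≠ 0 → E 3 l = 0) :
    ((((∑ l, (X : ℝ[X]) ^ (![0, 1, 7, 11] : Fin 4 → ℕ) l • (!![E 0 l, E 2 l, E 3 l; E 2 l, E 1 l, E 4 l; E 3 l, E 4 l, 0] :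
      Matrix (Fin 3) (Fin 3) ℝ).map C).det).roots.toFinset.filter (fun t => 0 < t)).card) ≤ 18 := by
  have hT : ((Finset.univ : Finset (Fin 4 × Fin 4 × Fin 4)).image
      (fun p => (![0, 1, 7, 11] : Fin 4 → ℕ) p.1 + (![0, 1, 7, 11] : Fin 4 → ℕ) p.2.1 + (![0, 1, 7, 11] : Fin 4 → ℕ) p.2.2))
        = ({0, 1, 2, 3, 7, 8, 9, 11, 12, 13, 14, 15, 18, 19, 21, 22, 23, 25, 29, 33} : Finset ℕ) := by decide
  refine card_posRoots_isoTangent_le_18 _ E 0 1 2 3 (by decide) (by decide) (by decide) (by decide) (by decide) (by decide) hU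
    (fun e => ((({0, 1, 2, 3, 7, 8, 9, 11, 12, 13, 14, 15, 18, 19, 21, 22, 23, 25, 29, 33} : Finset ℕ)).filter (· < e)).card) (fun e => by rw [hT]) ?_
  decide

/-- **`(0,2,5,26)`, border along the TOP monomial `X^26`** (the support of the definite-top exact seventeen `…DefiniteTopSeventeen`;
`m = 3`, face `{0,1,2}`): at most `18`. [folklore] -/
theorem card_posRoots_isoTangent_le_18_on_0_2_5_26_top (E : Fin 5 → Fin 4 → ℝ) (hU : ∀ l, l ≠ 3 → E 3 l = 0) :
    ((((∑ l, (X : ℝ[X]) ^ (![0, 2, 5, 26] : Fin 4 → ℕ) l • (!![E 0 l, E 2 l, E 3 l; E 2 l, E 1 l, E 4 l; E 3 l, E 4 l, 0] :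
      Matrix (Fin 3) (Fin 3) ℝ).map C).det).roots.toFinset.filter (fun t => 0 < t)).card) ≤ 18 := by
  have hT : ((Finset.univ : Finset (Fin 4 × Fin 4 × Fin 4)).image
      (fun p => (![0, 2, 5, 26] : Fin 4 → ℕ) p.1 + (![0, 2, 5, 26] : Fin 4 → ℕ) p.2.1 + (![0, 2, 5, 26] : Fin 4 → ℕ) p.2.2))
        = ({0, 2, 4, 5, 6, 7, 9, 10, 12, 15, 26, 28, 30, 31, 33, 36, 52, 54, 57, 78} : Finset ℕ) := by decide
  refine card_posRoots_isoTangent_le_18 _ E 3 0 1 2 (by decide) (by decide) (by decide) (by decide) (by decide) (by decide) hU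
    (fun e => ((({0, 2, 4, 5, 6, 7, 9, 10, 12, 15, 26, 28, 30, 31, 33, 36, 52, 54, 57, 78} : Finset ℕ)).filter (· < e)).card) (fun e => by rw [hT]) ?_
  decide

end Summit.ValiantsHypothesis.ValiantsHypothesis.Theorems.LacunarySymmetroidMatrixDescartes.Census
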